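import Summits.QuantumAdvantage.AdviceFreeQNC0.NPGamma37FourierFamily
import Summits.QuantumAdvantage.AdviceFreeQNC0.WindowLocalHard
import HarnessLib

/-!
# Cell qa-qnc0 — (NP-W) part 1: statements `RingHardWalkLocal3` / `RingHardWalkLocalLinForms3` and the assembly `fourierLossD`

Planner qa-qnc0-p2 gen 34 (INBOX P2-34j, memo HOME/qa-qnc0-p2/ROUND-34P2.md §4.10).  WALK-WINDOW POST-PROCESSING IS FREE
for the (NP-ΓΛ) slicing engine: on a slice `u = U p a v` all walk bits except the window bits `u_{p_j}` are frozen, so an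
output reading an arbitrary `w`-walk window reads, besides constants of `a`, at most one move bit `v_{j(g)}` = the singleton
letter `x_{p_{j(g)}}` up to a constant — slice by slice the strategy is an (NP-ΓΛ) strategy with one more polynomial and an
`a`-DEPENDENT table.  This file: the statements and `fourierLossD` (= `fourierLoss` verbatim for `a`-dependent tables and a
walk strategy agreeing slice-wise; the Kraft/sparsity step is table-blind, the resonance step only sees the polynomials).
Part 2 (`NPGamma37WalkLocal`): the slice identity and the theorems.
-/
noncomputable section

namespace Summit.QuantumAdvantage.AdviceFreeQNC0.NPGamma37Proof

open Finset F4
open Classical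
open Summit.QuantumAdvantage.AdviceFreeQNC0.AffBells37 (exists_ne_one_of_mass_lt ev L sparse_ne_one two_pow_L_le)
open Summit.QuantumAdvantage.AdviceFreeQNC0.Resonance37G (xN xN_eq_xOfU)

variable {F : ℕ}

section WalkLocal

open Literature.Computability.QuantumComplexity Literature.Computability.QuantumComplexity.RingHLF
open Literature.Computability.MetaComplexity
open AffBells23 AffBells26
open Summit.QuantumAdvantage.AdviceFreeQNC0.NPGamma37 (NCoupled InsulatedWindows)

variable {n : ℕ}
variable {N : ℕ}
variable {R : ℕ}

/-! ### Statements -/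

/-- An insulated window system (the data of `InsulatedWindows 𝓢 F`) whose windows are pairwise `d`-SEPARATED:
`p j + d ≤ p j'` for `j < j' < F`. -/
def InsulatedWindowsSep {N : ℕ} (𝓢 : Set (Finset (Fin N))) (F d : ℕ) : Prop :=
  ∃ p q : ℕ → ℕ,
    2 ≤ q 0 ∧ q F + 3 ≤ N ∧
    (∀ j < F, q j < p j ∧ p j + 1 < q (j + 1)) ∧
    (∀ j < F, ∀ j' < F, j ≠ j' → ∀ a ∈ ({p j, p j + 1} : Finset ℕ), ∀ b ∈ ({p j', p j' + 1} : Finset ℕ),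
        ¬ NCoupled 𝓢 a b) ∧
    (∀ i ≤ F, ∀ j < F, ∀ b ∈ ({p j, p j + 1} : Finset ℕ), ¬ NCoupled 𝓢 (q i) b) ∧
    (∀ j j' : ℕ, j < j' → j' < F → p j + d ≤ p j')

/-- Separated insulated windows are insulated windows. -/
theorem insulated_of_sep {𝓢 : Set (Finset (Fin N))} {F d : ℕ} (h : InsulatedWindowsSep 𝓢 F d) :
    InsulatedWindows 𝓢 F := by
  obtain ⟨p, q, h1, h2, h3, h4, h5, -⟩ := h
  exact ⟨p, q, h1, h2, h3, h4, h5⟩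

/-- **(NP-W) `RingHardWalkLocal3`**: a walk strategy at the ring charge `n + 2` whose output `g` is an ARBITRARY function of
(i) the values of `R < log₂(n+1)` polynomials in the span of a family `𝓢` admitting `C·log₂(n+1)` insulated windows that are
pairwise `(2w+3)`-separated and (ii) the walk window `u_{g−w}, …, u_{g+w−1}`, wins at most `(1 − (n+1)^{−e})·2ⁿ` walks. -/
def RingHardWalkLocal3 : Prop :=
  ∃ e C n₀ : ℕ, ∀ n : ℕ, n₀ ≤ n + 1 → ∀ w : ℕ, ∀ 𝓢 : Set (Finset (Fin (n + 1))),
    InsulatedWindowsSep 𝓢 (C * Nat.log 2 (n + 1)) (2 * w + 3) →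
    ∀ R < Nat.log 2 (n + 1), ∀ Q : Fin (n + 1) → Fin R → Smolensky.CubeFn (ZMod 3) (n + 1),
      (∀ g i, Q g i ∈ Submodule.span (ZMod 3) (Smolensky.mono (ZMod 3) '' 𝓢)) →
      ∀ Fg : Fin (n + 1) → (Fin R → ZMod 3) → (Fin n → Bool) → Bool,
        (∀ t, WindowLocal w (fun g u => Fg g t u)) →
        ((univ.filter fun u : Fin n → Bool =>
            ringWinU (n + 2) (fun g u => Fg g (fun i => Q g i (xOfU u)) u) u = true).card : ℝ)
          ≤ (1 - 1 / ((n : ℝ) + 1) ^ e) * (2 : ℝ) ^ n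

/-- **(NP-WΛ) `RingHardWalkLocalLinForms3`** = p1's (J2⁻) at the ring charge: `R < log₂(n+1)` arbitrary DENSE `𝔽₃`-linear
forms of the letters per output, post-processed by an ARBITRARY function of the walk window of radius `w`, for every `w` with
`8·log₂(n+1)·(2w+3) + 4 ≤ n`. -/
def RingHardWalkLocalLinForms3 : Prop :=
  ∃ e n₀ : ℕ, ∀ n ≥ n₀, ∀ w : ℕ, 8 * Nat.log 2 (n + 1) * (2 * w + 3) + 4 ≤ n →
    ∀ R < Nat.log 2 (n + 1), ∀ Lf : Fin (n + 1) → Fin R → Fin (n + 1) → ZMod 3,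
      ∀ Fg : Fin (n + 1) → (Fin R → ZMod 3) → (Fin n → Bool) → Bool,
        (∀ t, WindowLocal w (fun g u => Fg g t u)) →
        ((univ.filter fun u : Fin n → Bool =>
            ringWinU (n + 2) (fun g u => Fg g (fun i => ∑ m : Fin (n + 1), if xOfU u m then Lf g i m else 0) u) u
              = true).card : ℝ)
          ≤ (1 - 1 / ((n : ℝ) + 1) ^ e) * (2 : ℝ) ^ n

/-! ### The (NP-ΓΛ) assembly for `a`-dependent tables -/

/-- **`fourierLossD`** — `fourierLoss` verbatim, for a walk strategy `y` that agrees on every slice `U p a ·` with the class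
strategy `PQ Q (fa a)` of an `a`-DEPENDENT table `fa a` (the Kraft/sparsity step is table-blind and the resonance step only sees
the polynomials `QK Q k g`).  Conclusion in walk coordinates at the ring charge `n + 2`. -/
theorem fourierLossD {p q : ℕ → ℕ} (hord : ∀ j < F, q j < p j ∧ p j + 1 < q (j + 1)) (hqF : q F < n)
    (Q : Fin (n + 1) → Fin R → Smolensky.CubeFn (ZMod 3) (n + 1))
    (fa : (Fin n → Bool) → Fin (n + 1) → (Fin R → ZMod 3) → Bool) (y : Fin (n + 1) → (Fin n → Bool) → Bool)
    (hy : ∀ (a : Fin n → Bool) (v : Fin F → Bool), ringWinU (n + 2) y (U p a v) = Wn (PQ Q (fa a)) (U p a v))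
    (hSA : ∀ (k : Fin R → ZMod 3) (g : Fin (n + 1)), SA (n := n) p F (QK Q k g))
    (hIA : ∀ (k : Fin R → ZMod 3) (g : Fin (n + 1)), IA p q F (QK Q k g))
    (h34N : 8 * 3 ^ R * (n + 1) * 3 ^ F ≤ 4 ^ F) (h2C : 4 * (n + 1) * (8 * F) ≤ 2 ^ F) :
    (((univ.filter fun u : Fin n → Bool => ringWinU (n + 2) y u = true).card : ℕ) : ℝ)
      ≤ (2 : ℝ) ^ n - (2 : ℝ) ^ n / (2 * (2 : ℝ) ^ L (Fintype.card (IxL n F R) + 1)) := by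
  have hS : Sep n F p := sep_of_ord hord hqF
  haveI := F4.nontrivial
  -- wins and losses of the transported game
  set Los := univ.filter (fun u : Fin n → Bool => ringWinU (n + 2) y u = false) with hLos
  have hWL : (univ.filter fun u : Fin n → Bool => ringWinU (n + 2) y u = true).card + Los.card = 2 ^ n := by
    have h := Finset.card_filter_add_card_filter_not (s := (univ : Finset (Fin n → Bool)))
      (fun u => ringWinU (n + 2) y u = true)
    rw [card_univ, Fintype.card_fun, Fintype.card_bool, Fintype.card_fin] at h
    rw [← h, hLos]
    congr 2
    exact filter_congr fun u _ => by cases ringWinU (n + 2) y u <;> simp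
  -- masses of slices
  set K := Fintype.card (IxL n F R) with hK
  set massN : (Fin n → Bool) → ℕ := fun a => ∑ b : IxL n F R, 2 ^ (F - AffBells37.wt (rowsQ Q p a b)) with hmassN
  set Good := univ.filter (fun a : Fin n → Bool => massN a < 2 ^ F) with hGood
  set Bad := univ.filter (fun a : Fin n → Bool => ¬ massN a < 2 ^ F) with hBad
  have hGB : Good.card + Bad.card = 2 ^ n := by
    rw [hGood, hBad, Finset.card_filter_add_card_filter_not, card_univ, Fintype.card_fun, Fintype.card_bool,
      Fintype.card_fin]
  -- Step A: a good slice loses `≥ 2^{F} / 2^{L(K+1)}` points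
  set cnt : (Fin n → Bool) → ℕ := fun a => (univ.filter fun v : Fin F → Bool => ringWinU (n + 2) y (U p a v) = false).card
    with hcnt
  have hA : ∀ a ∈ Good, 2 ^ F ≤ 2 ^ L (K + 1) * cnt a := by
    intro a ha
    rw [hGood, mem_filter] at ha
    have hex := exists_ne_one_of_mass_lt F univ (rowsQ Q p a) (coefsQ Q (fa a) p a) ha.2
    have hsp := sparse_ne_one F univ (rowsQ Q p a) (coefsQ Q (fa a) p a) hex
    rw [card_univ, ← hK, card_loss_sliceQ hS Q (fa a) hSA a] at hsp
    have hc : cnt a = (univ.filter fun v : Fin F → Bool => Wn (PQ Q (fa a)) (U p a v) = false).card := by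
      rw [hcnt]
      exact congrArg Finset.card (filter_congr fun v _ => by rw [hy a v])
    rw [hc]
    exact hsp
  -- Step B: summing over good slices and re-randomising: `#Good ≤ 2^{L(K+1)} · #Los`
  have hsumcnt : ∑ a : Fin n → Bool, cnt a = 2 ^ F * Los.card := by
    have h1 : ∀ a, cnt a = ∑ v : Fin F → Bool, (if ringWinU (n + 2) y (U p a v) = false then 1 else 0) := by
      intro a; rw [hcnt]; exact card_filter _ _
    simp_rw [h1]
    rw [sum_comm, sum_sum_U p (fun u => if ringWinU (n + 2) y u = false then 1 else 0), hLos, card_filter]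
  have hB : Good.card ≤ 2 ^ L (K + 1) * Los.card := by
    have h1 : Good.card * 2 ^ F ≤ 2 ^ L (K + 1) * (2 ^ F * Los.card) := by
      calc Good.card * 2 ^ F = ∑ a ∈ Good, 2 ^ F := by rw [sum_const, smul_eq_mul]
        _ ≤ ∑ a ∈ Good, 2 ^ L (K + 1) * cnt a := sum_le_sum hA
        _ ≤ ∑ a, 2 ^ L (K + 1) * cnt a :=
            sum_le_sum_of_subset_of_nonneg (subset_univ _) fun _ _ _ => Nat.zero_le _
        _ = 2 ^ L (K + 1) * (2 ^ F * Los.card) := by rw [← mul_sum, hsumcnt]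
    have hpos : 0 < 2 ^ F := by positivity
    rw [show 2 ^ L (K + 1) * (2 ^ F * Los.card) = (2 ^ L (K + 1) * Los.card) * 2 ^ F by ring] at h1
    exact Nat.le_of_mul_le_mul_right h1 hpos
  -- Step C: bad slices are rare (mass bookkeeping + resonance MGF + Markov)
  set C : ℕ := 2 * (n + 1) * (8 * F) with hC
  set T : (Fin n → Bool) → ℝ := fun a => ∑ g : Fin (n + 1), ∑ σ : Bool, ∑ k : Fin R → ZMod 3,
      (2 : ℝ) ^ Zcount (F := F) (QK Q k) p a g (σv σ) 1 with hT
  have hmass : ∀ a, (massN a : ℝ) ≤ C + T a := by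
    intro a
    have h := mass_rows_leQ (F := F) Q p a
    have h' : ((massN a : ℕ) : ℝ) ≤ ((2 * (n + 1) * (8 * F) +
        ∑ g : Fin (n + 1), ∑ σ : Bool, ∑ k : Fin R → ZMod 3,
          2 ^ Zcount (F := F) (QK Q k) p a g (σv σ) 1 : ℕ) : ℝ) := by
      exact_mod_cast h
    have hC' : (C : ℝ) = 2 * ((n : ℝ) + 1) * (8 * (F : ℝ)) := by rw [hC]; push_cast; ring
    have hT' : T a = ∑ g : Fin (n + 1), ∑ σ : Bool, ∑ k : Fin R → ZMod 3,
        (2 : ℝ) ^ Zcount (F := F) (QK Q k) p a g (σv σ) 1 := rfl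
    rw [hC', hT']
    push_cast at h'
    linarith
  have h3R : (Fintype.card (Fin R → ZMod 3) : ℝ) = (3 : ℝ) ^ R := by
    rw [Fintype.card_fun, ZMod.card, Fintype.card_fin]; push_cast; ring
  have hTsum : ∑ a : Fin n → Bool, T a ≤ 2 * (3 : ℝ) ^ R * (n + 1) * ((2 : ℝ) ^ n * (3 / 2 : ℝ) ^ F) := by
    rw [hT, sum_comm]
    have hg : ∀ g : Fin (n + 1), ∑ a : Fin n → Bool, ∑ σ : Bool, ∑ k : Fin R → ZMod 3,
        (2 : ℝ) ^ Zcount (F := F) (QK Q k) p a g (σv σ) 1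
          ≤ 2 * (3 : ℝ) ^ R * ((2 : ℝ) ^ n * (3 / 2 : ℝ) ^ F) := by
      intro g
      rw [sum_comm]
      have hσ : ∀ σ : Bool, ∑ a : Fin n → Bool, ∑ k : Fin R → ZMod 3,
          (2 : ℝ) ^ Zcount (F := F) (QK Q k) p a g (σv σ) 1
            ≤ (3 : ℝ) ^ R * ((2 : ℝ) ^ n * (3 / 2 : ℝ) ^ F) := by
        intro σ
        rw [sum_comm]
        have hk : ∀ k : Fin R → ZMod 3, ∑ a : Fin n → Bool,
            (2 : ℝ) ^ Zcount (F := F) (QK Q k) p a g (σv σ) 1 ≤ (2 : ℝ) ^ n * (3 / 2 : ℝ) ^ F :=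
          fun k => resonance_poly hord hqF (QK Q k) (hIA k) g (σv σ) 1 (σv_ne_zero σ) one_ne_zero
        calc _ ≤ ∑ _k : Fin R → ZMod 3, (2 : ℝ) ^ n * (3 / 2 : ℝ) ^ F := sum_le_sum fun k _ => hk k
          _ = (3 : ℝ) ^ R * ((2 : ℝ) ^ n * (3 / 2 : ℝ) ^ F) := by rw [sum_const, card_univ, nsmul_eq_mul, h3R]
      calc _ ≤ ∑ σ : Bool, (3 : ℝ) ^ R * ((2 : ℝ) ^ n * (3 / 2 : ℝ) ^ F) := sum_le_sum fun σ _ => hσ σ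
        _ = _ := by rw [Fintype.sum_bool]; ring
    calc _ ≤ ∑ g : Fin (n + 1), 2 * (3 : ℝ) ^ R * ((2 : ℝ) ^ n * (3 / 2 : ℝ) ^ F) := sum_le_sum fun g _ => hg g
      _ = _ := by rw [sum_const, card_univ, Fintype.card_fin]; ring
  have hBadR : (Bad.card : ℝ) * ((2 : ℝ) ^ F - C) ≤ 2 * (3 : ℝ) ^ R * (n + 1) * ((2 : ℝ) ^ n * (3 / 2 : ℝ) ^ F) := by
    have h1 : ∀ a ∈ Bad, ((2 : ℝ) ^ F - C) ≤ T a := by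
      intro a ha
      rw [hBad, mem_filter, not_lt] at ha
      have h2 : ((2 ^ F : ℕ) : ℝ) ≤ (massN a : ℝ) := by exact_mod_cast ha.2
      push_cast at h2
      linarith [hmass a]
    have hTnn : ∀ a, 0 ≤ T a := by
      intro a; rw [hT]
      exact sum_nonneg fun g _ => sum_nonneg fun σ _ => sum_nonneg fun k _ => by positivity
    calc (Bad.card : ℝ) * ((2 : ℝ) ^ F - C) = ∑ a ∈ Bad, ((2 : ℝ) ^ F - C) := by
          rw [sum_const, nsmul_eq_mul]
      _ ≤ ∑ a ∈ Bad, T a := sum_le_sum h1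
      _ ≤ ∑ a, T a := sum_le_sum_of_subset_of_nonneg (subset_univ _) fun a _ _ => hTnn a
      _ ≤ _ := hTsum
  -- Step D: the numbers
  have hC2 : 2 * (C : ℝ) ≤ (2 : ℝ) ^ F := by
    have h : 2 * C ≤ 2 ^ F := by
      calc 2 * C = 4 * (n + 1) * (8 * F) := by rw [hC]; ring
        _ ≤ 2 ^ F := h2C
    exact_mod_cast h
  have h34 : 8 * (3 : ℝ) ^ R * ((n : ℝ) + 1) * (3 : ℝ) ^ F ≤ (4 : ℝ) ^ F := by exact_mod_cast h34N
  have hBadle : (Bad.card : ℝ) ≤ (2 : ℝ) ^ n / 2 := by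
    have hpos2 : (0 : ℝ) < (2 : ℝ) ^ F := by positivity
    have hCnn : (0 : ℝ) ≤ C := by positivity
    have h1 : (Bad.card : ℝ) * ((2 : ℝ) ^ F / 2) ≤ 2 * (3 : ℝ) ^ R * (n + 1) * ((2 : ℝ) ^ n * (3 / 2 : ℝ) ^ F) := by
      have hb : (0 : ℝ) ≤ Bad.card := by positivity
      calc (Bad.card : ℝ) * ((2 : ℝ) ^ F / 2) ≤ (Bad.card : ℝ) * ((2 : ℝ) ^ F - C) :=
            mul_le_mul_of_nonneg_left (by linarith) hb
        _ ≤ _ := hBadR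
    have h32 : (3 / 2 : ℝ) ^ F * (2 : ℝ) ^ F = (3 : ℝ) ^ F := by
      rw [← mul_pow]; norm_num
    have h42 : (4 : ℝ) ^ F = (2 : ℝ) ^ F * (2 : ℝ) ^ F := by
      rw [← mul_pow]; norm_num
    have key : (8 * (3 : ℝ) ^ R * ((n : ℝ) + 1) * (3 / 2 : ℝ) ^ F) * (2 : ℝ) ^ F ≤ (2 : ℝ) ^ F * (2 : ℝ) ^ F := by
      calc (8 * (3 : ℝ) ^ R * ((n : ℝ) + 1) * (3 / 2 : ℝ) ^ F) * (2 : ℝ) ^ F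
          = 8 * (3 : ℝ) ^ R * ((n : ℝ) + 1) * ((3 / 2 : ℝ) ^ F * (2 : ℝ) ^ F) := by ring
        _ = 8 * (3 : ℝ) ^ R * ((n : ℝ) + 1) * (3 : ℝ) ^ F := by rw [h32]
        _ ≤ (4 : ℝ) ^ F := h34
        _ = (2 : ℝ) ^ F * (2 : ℝ) ^ F := h42
    have h34' : 8 * (3 : ℝ) ^ R * ((n : ℝ) + 1) * (3 / 2 : ℝ) ^ F ≤ (2 : ℝ) ^ F := le_of_mul_le_mul_right key hpos2
    have h2 : (Bad.card : ℝ) * ((2 : ℝ) ^ F / 2) ≤ ((2 : ℝ) ^ n / 2) * ((2 : ℝ) ^ F / 2) :=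
      h1.trans (by
        calc 2 * (3 : ℝ) ^ R * ((n : ℝ) + 1) * ((2 : ℝ) ^ n * (3 / 2 : ℝ) ^ F)
            = ((2 : ℝ) ^ n / 4) * (8 * (3 : ℝ) ^ R * ((n : ℝ) + 1) * (3 / 2 : ℝ) ^ F) := by ring
          _ ≤ ((2 : ℝ) ^ n / 4) * (2 : ℝ) ^ F := mul_le_mul_of_nonneg_left h34' (by positivity)
          _ = ((2 : ℝ) ^ n / 2) * ((2 : ℝ) ^ F / 2) := by ring)
    exact le_of_mul_le_mul_right h2 (by positivity)
  -- Step E: conclude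
  have hGoodR : (2 : ℝ) ^ n / 2 ≤ Good.card := by
    have h : ((Good.card + Bad.card : ℕ) : ℝ) = (2 : ℝ) ^ n := by rw [hGB]; push_cast; ring
    push_cast at h
    linarith
  have hLosR : (2 : ℝ) ^ n / 2 ≤ (2 : ℝ) ^ L (K + 1) * Los.card := by
    have h : (Good.card : ℝ) ≤ ((2 ^ L (K + 1) * Los.card : ℕ) : ℝ) := by exact_mod_cast hB
    push_cast at h
    linarith
  have hWR : ((univ.filter fun u : Fin n → Bool => ringWinU (n + 2) y u = true).card : ℝ) = (2 : ℝ) ^ n - Los.card := by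
    have h : (((univ.filter fun u : Fin n → Bool => ringWinU (n + 2) y u = true).card + Los.card : ℕ) : ℝ) = (2 : ℝ) ^ n := by
      rw [hWL]; push_cast; ring
    push_cast at h
    linarith
  have hpowL : (0 : ℝ) < (2 : ℝ) ^ L (K + 1) := by positivity
  calc (((univ.filter fun u : Fin n → Bool => ringWinU (n + 2) y u = true).card : ℕ) : ℝ)
      = (2 : ℝ) ^ n - Los.card := hWR
    _ ≤ (2 : ℝ) ^ n - (2 : ℝ) ^ n / (2 * (2 : ℝ) ^ L (K + 1)) := by
        have : (2 : ℝ) ^ n / (2 * (2 : ℝ) ^ L (K + 1)) ≤ Los.card := by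
          rw [div_le_iff₀ (by positivity)]
          calc (2 : ℝ) ^ n = 2 * ((2 : ℝ) ^ n / 2) := by ring
            _ ≤ 2 * ((2 : ℝ) ^ L (K + 1) * Los.card) := by linarith
            _ = (Los.card : ℝ) * (2 * (2 : ℝ) ^ L (K + 1)) := by ring
        linarith


end WalkLocal

end Summit.QuantumAdvantage.AdviceFreeQNC0.NPGamma37Proof

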